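import Mathlib
import HarnessLib

/-!
# `NoHeavyLowerTail` (crux stmt-CriticalPhenomena-4575), antithetic vdBHK programme: the APEX LEMMA (tool T18) — antipodal Kleitman is preserved by the
# 'crossing-rung' extension `A(X; r)`

Support file (seat `prim-ineq-gen-7` gen 44; `--supports stmt-CriticalPhenomena-4575`).  No `sorry`, no definitions.
Memo: run/shared/lean/prim/prim-ineq-gen-7/FINDING-MULTISINK-g44.md §0‴.

SETTING.  `X` a finite partial order with an antitone involution `ι` (not needed as hypotheses below beyond what is used) which is ANTIPODAL KLEITMAN in the
up-set form: `#(V ∩ ι Y) ≤ #(V ∩ Y)` for all up-sets `V, Y`.  Let `r` be MINIMAL with `ι r` MAXIMAL and `r ≤ ι r`, `r ≠ ι r`.  The CROSSING-RUNG EXTENSION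
`A(X;r)` is the poset on `X × {0,1}` with `(s,i) ≤ (u,i) ⟺ s ≤ u`, `(s,1) ≤ (u,0) ⟺ (s,u) = (r, ι r)`, `(s,0) ≤ (u,1) ⟺ s ≤ u ∧ s ≠ ι r ∧ u ≠ r`, involution
`(s,i) ↦ (ι s, 1−i)` — the product `X × {0<1}` with the two vertical rungs at `r`, `ι r` replaced by the one rung `(r,1) < (ι r,0)`.  Its up-sets are exactly the
pairs `(U₀, U₁)` of up-sets of `X` with  (α) `U₀ ∖ {r, ι r} ⊆ U₁`,  (β) `r ∈ U₀ ⟹ ↑r ∖ {r} ⊆ U₁`,  (γ) `r ∈ U₁ ⟹ ι r ∈ U₀`  (memo §0‴), and AK for `A(X;r)`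
reads, for two such pairs `(U₀,U₁)`, `(W₀,W₁)`:  `#(U₀ ∩ ιW₁) + #(U₁ ∩ ιW₀) ≤ #(U₀ ∩ W₀) + #(U₁ ∩ W₁)`.
* `AntitheticApex.chain_product_ak` — AK of `X × {0<1}` in this two-layer form (pairs `V₀ ⊆ V₁`), from AK of `X` by `|A|+|B| = |A∪B|+|A∩B|`.
* `AntitheticApex.apex_ak` — **THE APEX LEMMA**: AK of `A(X;r)` in the two-layer form.  Proof: move `r` into the upper layer and `ι r` out of the lower layer to
  get a product pair, apply `chain_product_ak`, and check that the four boundary corrections at `r`, `ι r` have the right sign (a finite Boolean verification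
  over the eight memberships of `r`, `ι r`, under (β), (γ) and `r ≤ ι r`).
APPLICATION (memo §0″–§0‴): for the poset antimatroid of a finite poset `P`, adding a TOP element is exactly `A(Ω_P; all-red)`; with products for disjoint unions
this proves the ANTIMATROID AK conjecture for the poset antimatroids of all inverted forests — the first AK theorems for non-graphic antimatroids.
-/

namespace Summit.CriticalPhenomena.PercolationContinuityZ3.Theorems

open Finset

namespace AntitheticApex

variable {X : Type*} [DecidableEq X] [PartialOrder X]

omit [PartialOrder X] in
/-- Replacing `Y` by `ι Y` inside `V ∩ ·`: membership. [this work] -/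
theorem mem_image_invol (ι : X → X) (hιι : Function.Involutive ι) (Y : Finset X) (x : X) :
    x ∈ Y.image ι ↔ ι x ∈ Y := by
  constructor
  · rintro h
    obtain ⟨y, hy, rfl⟩ := Finset.mem_image.1 h
    rwa [hιι y]
  · intro h
    exact Finset.mem_image.2 ⟨ι x, h, hιι x⟩

/-- AK of the product `X × {0 < 1}` in two-layer form: for up-sets `V₀ ⊆ V₁`, `Y₀ ⊆ Y₁` of an AK poset `X`,
`#(V₀ ∩ ιY₁) + #(V₁ ∩ ιY₀) ≤ #(V₀ ∩ Y₀) + #(V₁ ∩ Y₁)`. [this work] -/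
theorem chain_product_ak (ι : X → X) (hιι : Function.Involutive ι)
    (hAK : ∀ V Y : Finset X, (∀ x y, x ≤ y → x ∈ V → y ∈ V) → (∀ x y, x ≤ y → x ∈ Y → y ∈ Y) →
      (V ∩ Y.image ι).card ≤ (V ∩ Y).card)
    (V₀ V₁ Y₀ Y₁ : Finset X)
    (hV₀ : ∀ x y, x ≤ y → x ∈ V₀ → y ∈ V₀) (hV₁ : ∀ x y, x ≤ y → x ∈ V₁ → y ∈ V₁)
    (hY₀ : ∀ x y, x ≤ y → x ∈ Y₀ → y ∈ Y₀) (hY₁ : ∀ x y, x ≤ y → x ∈ Y₁ → y ∈ Y₁)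
    (hV : V₀ ⊆ V₁) (hY : Y₀ ⊆ Y₁) :
    (V₀ ∩ Y₁.image ι).card + (V₁ ∩ Y₀.image ι).card ≤ (V₀ ∩ Y₀).card + (V₁ ∩ Y₁).card := by
  have h0 := hAK V₀ Y₀ hV₀ hY₀
  have h1 := hAK V₁ Y₁ hV₁ hY₁
  set A := V₀ ∩ Y₁.image ι
  set B := V₁ ∩ Y₀.image ι
  have hAB : A.card + B.card = (A ∪ B).card + (A ∩ B).card := (Finset.card_union_add_card_inter A B).symm
  have hunion : A ∪ B ⊆ V₁ ∩ Y₁.image ι := by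
    intro x hx
    rcases Finset.mem_union.1 hx with h | h
    · obtain ⟨hx1, hx2⟩ := Finset.mem_inter.1 h
      exact Finset.mem_inter.2 ⟨hV hx1, hx2⟩
    · obtain ⟨hx1, hx2⟩ := Finset.mem_inter.1 h
      refine Finset.mem_inter.2 ⟨hx1, ?_⟩
      rw [mem_image_invol ι hιι] at hx2 ⊢
      exact hY hx2
  have hinter : A ∩ B ⊆ V₀ ∩ Y₀.image ι := by
    intro x hx
    obtain ⟨ha, hb⟩ := Finset.mem_inter.1 hx
    exact Finset.mem_inter.2 ⟨(Finset.mem_inter.1 ha).1, (Finset.mem_inter.1 hb).2⟩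
  have c1 := Finset.card_le_card hunion
  have c2 := Finset.card_le_card hinter
  omega

omit [PartialOrder X] in
/-- Cardinalities of two finite sets that agree off one point `p` (with the memberships of `p` named `P`, `Q`). [this work] -/
theorem card_eq_off_point (S S' : Finset X) (p : X) (h : ∀ x, x ≠ p → (x ∈ S ↔ x ∈ S'))
    (P Q : Prop) [Decidable P] [Decidable Q] (hP : p ∈ S ↔ P) (hQ : p ∈ S' ↔ Q) :
    (S.card : ℤ) - (if P then 1 else 0) = (S'.card : ℤ) - (if Q then 1 else 0) := by
  have he : S.erase p = S'.erase p := by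
    ext x
    simp only [Finset.mem_erase]
    constructor
    · rintro ⟨hx, hs⟩; exact ⟨hx, (h x hx).1 hs⟩
    · rintro ⟨hx, hs⟩; exact ⟨hx, (h x hx).2 hs⟩
  have e1 : ((S.erase p).card : ℤ) = (S.card : ℤ) - (if P then 1 else 0) := by
    by_cases hp : p ∈ S
    · rw [if_pos (hP.1 hp)]
      have h1 := Finset.card_erase_add_one hp
      omega
    · rw [if_neg (fun hh => hp (hP.2 hh)), Finset.erase_eq_of_notMem hp]
      simp
  have e2 : ((S'.erase p).card : ℤ) = (S'.card : ℤ) - (if Q then 1 else 0) := by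
    by_cases hp : p ∈ S'
    · rw [if_pos (hQ.1 hp)]
      have h1 := Finset.card_erase_add_one hp
      omega
    · rw [if_neg (fun hh => hp (hQ.2 hh)), Finset.erase_eq_of_notMem hp]
      simp
  rw [← e1, ← e2, he]

/-- The Boolean core of the apex lemma: under the constraints coming from (β), (γ) and `r ≤ ι r`, the boundary corrections have the right sign. [this work] -/
theorem apex_core (u0r u1r u0b u1b w0r w1r w0b w1b : Bool)
    (hu1 : u0r = true → u0b = true) (hu2 : u1r = true → u1b = true) (hu3 : u0r = true → u1r = false → u1b = true) (hu4 : u1r = true → u0b = true)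
    (hw1 : w0r = true → w0b = true) (hw2 : w1r = true → w1b = true) (hw3 : w0r = true → w1r = false → w1b = true) (hw4 : w1r = true → w0b = true) :
    ((if (u0b && u1b) && (w0b && w1b) then (1:ℤ) else 0) - (if u0b && w0b then 1 else 0))
      + ((if (u0r || u1r) && (w0r || w1r) then (1:ℤ) else 0) - (if u1r && w1r then 1 else 0))
      ≤ ((if (u0b && u1b) && (w0r || w1r) then (1:ℤ) else 0) - (if u0b && w1r then 1 else 0))
      + ((if (u0r || u1r) && (w0b && w1b) then (1:ℤ) else 0) - (if u1r && w0b then 1 else 0)) := by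
  cases u0r <;> cases u1r <;> cases u0b <;> cases u1b <;> cases w0r <;> cases w1r <;> cases w0b <;> cases w1b <;> simp_all

/-- **THE APEX LEMMA (T18).**  Let `X` be a finite partial order, `ι` an involution of `X`, AK in up-set form
(`#(V ∩ ιY) ≤ #(V ∩ Y)` for all up-sets `V, Y`), and `r` an element with `r ≤ ι r`, `r ≠ ι r` and `ι r` maximal (minimality of `r`, needed only to make
`A(X;r)` a poset, is not used by the inequality).  Then for all pairs
`(U₀,U₁)`, `(W₀,W₁)` of up-sets of `X` satisfying (α) `U₀ ∖ {r, ι r} ⊆ U₁`, (β) `r ∈ U₀ ⟹ ↑r ∖ {r} ⊆ U₁`, (γ) `r ∈ U₁ ⟹ ι r ∈ U₀` (= the up-sets of the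
crossing-rung extension `A(X;r)`):  `#(U₀ ∩ ιW₁) + #(U₁ ∩ ιW₀) ≤ #(U₀ ∩ W₀) + #(U₁ ∩ W₁)` — i.e. `A(X;r)` is antipodal Kleitman. [this work] -/
theorem apex_ak (ι : X → X) (hιι : Function.Involutive ι)
    (hAK : ∀ V Y : Finset X, (∀ x y, x ≤ y → x ∈ V → y ∈ V) → (∀ x y, x ≤ y → x ∈ Y → y ∈ Y) →
      (V ∩ Y.image ι).card ≤ (V ∩ Y).card)
    (r : X) (hmax : ∀ s, ι r ≤ s → s = ι r) (hrr : r ≤ ι r) (hne : r ≠ ι r)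
    (U₀ U₁ W₀ W₁ : Finset X)
    (hU₀ : ∀ x y, x ≤ y → x ∈ U₀ → y ∈ U₀) (hU₁ : ∀ x y, x ≤ y → x ∈ U₁ → y ∈ U₁)
    (hW₀ : ∀ x y, x ≤ y → x ∈ W₀ → y ∈ W₀) (hW₁ : ∀ x y, x ≤ y → x ∈ W₁ → y ∈ W₁)
    (hUa : ∀ x, x ∈ U₀ → x ≠ r → x ≠ ι r → x ∈ U₁) (hUb : r ∈ U₀ → ∀ y, r ≤ y → y ≠ r → y ∈ U₁) (hUc : r ∈ U₁ → ι r ∈ U₀)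
    (hWa : ∀ x, x ∈ W₀ → x ≠ r → x ≠ ι r → x ∈ W₁) (hWb : r ∈ W₀ → ∀ y, r ≤ y → y ≠ r → y ∈ W₁) (hWc : r ∈ W₁ → ι r ∈ W₀) :
    (U₀ ∩ W₁.image ι).card + (U₁ ∩ W₀.image ι).card ≤ (U₀ ∩ W₀).card + (U₁ ∩ W₁).card := by
  have hιr : ι (ι r) = r := hιι r
  -- the product pair: move r into the upper layer, drop ι r from the lower layer when they are 'solitary'
  let UQ₀ : Finset X := if (ι r ∈ U₀ ∧ ι r ∉ U₁) then U₀.erase (ι r) else U₀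
  let UQ₁ : Finset X := if (r ∈ U₀ ∧ r ∉ U₁) then insert r U₁ else U₁
  let WQ₀ : Finset X := if (ι r ∈ W₀ ∧ ι r ∉ W₁) then W₀.erase (ι r) else W₀
  let WQ₁ : Finset X := if (r ∈ W₀ ∧ r ∉ W₁) then insert r W₁ else W₁
  -- generic facts about the construction (stated for U, reused for W)
  have Q0_up : ∀ (A₀ A₁ : Finset X), (∀ x y, x ≤ y → x ∈ A₀ → y ∈ A₀) → (∀ x y, x ≤ y → x ∈ A₁ → y ∈ A₁) →
      (∀ x, x ∈ A₀ → x ≠ r → x ≠ ι r → x ∈ A₁) → (r ∈ A₀ → ∀ y, r ≤ y → y ≠ r → y ∈ A₁) →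
      ∀ x y, x ≤ y → x ∈ (if (ι r ∈ A₀ ∧ ι r ∉ A₁) then A₀.erase (ι r) else A₀) → y ∈ (if (ι r ∈ A₀ ∧ ι r ∉ A₁) then A₀.erase (ι r) else A₀) := by
    intro A₀ A₁ hA₀ hA₁ hAa hAb x y hxy hx
    split_ifs at hx ⊢ with hc
    · rw [Finset.mem_erase] at hx ⊢
      refine ⟨?_, hA₀ x y hxy hx.2⟩
      intro hy
      -- y = ι r above x ∈ A₀ ∖ {ι r}: then ι r ∈ A₁, contradicting hc
      apply hc.2
      by_cases hxr : x = r
      · rw [hxr] at hxy; rw [← hy]; exact hAb (hxr ▸ hx.2) y hxy (fun e => hne (e.symm.trans hy))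
      · have hx1 : x ∈ A₁ := hAa x hx.2 hxr hx.1
        rw [← hy]; exact hA₁ x y hxy hx1
    · exact hA₀ x y hxy hx
  have Q1_up : ∀ (A₀ A₁ : Finset X), (∀ x y, x ≤ y → x ∈ A₁ → y ∈ A₁) → (r ∈ A₀ → ∀ y, r ≤ y → y ≠ r → y ∈ A₁) →
      ∀ x y, x ≤ y → x ∈ (if (r ∈ A₀ ∧ r ∉ A₁) then insert r A₁ else A₁) → y ∈ (if (r ∈ A₀ ∧ r ∉ A₁) then insert r A₁ else A₁) := by
    intro A₀ A₁ hA₁ hAb x y hxy hx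
    split_ifs at hx ⊢ with hc
    · rw [Finset.mem_insert] at hx ⊢
      rcases hx with rfl | hx
      · by_cases hy : y = x
        · exact Or.inl hy
        · exact Or.inr (hAb hc.1 y hxy hy)
      · exact Or.inr (hA₁ x y hxy hx)
    · exact hA₁ x y hxy hx
  have Q_sub : ∀ (A₀ A₁ : Finset X), (∀ x, x ∈ A₀ → x ≠ r → x ≠ ι r → x ∈ A₁) →
      (if (ι r ∈ A₀ ∧ ι r ∉ A₁) then A₀.erase (ι r) else A₀) ⊆ (if (r ∈ A₀ ∧ r ∉ A₁) then insert r A₁ else A₁) := by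
    intro A₀ A₁ hAa x hx
    have hx0 : x ∈ A₀ := by
      split_ifs at hx with hc
      · exact (Finset.mem_erase.1 hx).2
      · exact hx
    have goal : x ∈ A₁ ∨ (x = r ∧ r ∈ A₀ ∧ r ∉ A₁) := by
      by_cases hxr : x = r
      · subst hxr
        by_cases h1 : x ∈ A₁
        · exact Or.inl h1
        · exact Or.inr ⟨rfl, hx0, h1⟩
      · by_cases hxb : x = ι r
        · subst hxb
          split_ifs at hx with hc
          · exact absurd rfl (Finset.mem_erase.1 hx).1
          · left; by_contra h1; exact hc ⟨hx0, h1⟩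
        · exact Or.inl (hAa x hx0 hxr hxb)
    split_ifs with hc
    · rw [Finset.mem_insert]
      rcases goal with h | ⟨h, -⟩
      · exact Or.inr h
      · exact Or.inl h
    · rcases goal with h | ⟨hxr, h1, h2⟩
      · exact h
      · exact absurd ⟨h1, h2⟩ hc
  -- the product inequality
  have hP := chain_product_ak ι hιι hAK UQ₀ UQ₁ WQ₀ WQ₁ (Q0_up U₀ U₁ hU₀ hU₁ hUa hUb) (Q1_up U₀ U₁ hU₁ hUb) (Q0_up W₀ W₁ hW₀ hW₁ hWa hWb) (Q1_up W₀ W₁ hW₁ hWb)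
    (Q_sub U₀ U₁ hUa) (Q_sub W₀ W₁ hWa)
  -- memberships of the two special points in the Q-sets
  have mQ1 : ∀ (A₀ A₁ : Finset X), r ∈ (if (r ∈ A₀ ∧ r ∉ A₁) then insert r A₁ else A₁) ↔ (r ∈ A₀ ∨ r ∈ A₁) := by
    intro A₀ A₁
    split_ifs with hc
    · simp only [Finset.mem_insert, true_or, true_iff]; exact Or.inl hc.1
    · constructor
      · intro h; exact Or.inr h
      · rintro (h | h)
        · by_contra h1; exact hc ⟨h, h1⟩
        · exact h
  have mQ0 : ∀ (A₀ A₁ : Finset X), ι r ∈ (if (ι r ∈ A₀ ∧ ι r ∉ A₁) then A₀.erase (ι r) else A₀) ↔ (ι r ∈ A₀ ∧ ι r ∈ A₁) := by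
    intro A₀ A₁
    split_ifs with hc
    · simp only [Finset.mem_erase, ne_eq, not_true_eq_false, false_and, false_iff, not_and]
      intro _; exact hc.2
    · constructor
      · intro h; exact ⟨h, by by_contra h1; exact hc ⟨h, h1⟩⟩
      · intro h; exact h.1
  -- off the special point the Q-sets agree with the originals
  have offQ1 : ∀ (A₀ A₁ : Finset X) (x : X), x ≠ r → (x ∈ (if (r ∈ A₀ ∧ r ∉ A₁) then insert r A₁ else A₁) ↔ x ∈ A₁) := by
    intro A₀ A₁ x hx
    split_ifs with hc
    · rw [Finset.mem_insert]; constructor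
      · rintro (h | h); · exact absurd h hx
        · exact h
      · intro h; exact Or.inr h
    · exact Iff.rfl
  have offQ0 : ∀ (A₀ A₁ : Finset X) (x : X), x ≠ ι r → (x ∈ (if (ι r ∈ A₀ ∧ ι r ∉ A₁) then A₀.erase (ι r) else A₀) ↔ x ∈ A₀) := by
    intro A₀ A₁ x hx
    split_ifs with hc
    · rw [Finset.mem_erase]; constructor
      · intro h; exact h.2
      · intro h; exact ⟨hx, h⟩
    · exact Iff.rfl
  -- the four cardinality corrections (each pair of sets agrees off one point)
  have c00 := card_eq_off_point (U₀ ∩ W₀) (UQ₀ ∩ WQ₀) (ι r) (by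
      intro x hx
      simp only [Finset.mem_inter]
      rw [offQ0 U₀ U₁ x hx, offQ0 W₀ W₁ x hx])
    (ι r ∈ U₀ ∧ ι r ∈ W₀) ((ι r ∈ U₀ ∧ ι r ∈ U₁) ∧ (ι r ∈ W₀ ∧ ι r ∈ W₁))
    (by rw [Finset.mem_inter]) (by rw [Finset.mem_inter, mQ0 U₀ U₁, mQ0 W₀ W₁])
  have c11 := card_eq_off_point (U₁ ∩ W₁) (UQ₁ ∩ WQ₁) r (by
      intro x hx
      simp only [Finset.mem_inter]
      rw [offQ1 U₀ U₁ x hx, offQ1 W₀ W₁ x hx])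
    (r ∈ U₁ ∧ r ∈ W₁) ((r ∈ U₀ ∨ r ∈ U₁) ∧ (r ∈ W₀ ∨ r ∈ W₁))
    (by rw [Finset.mem_inter]) (by rw [Finset.mem_inter, mQ1 U₀ U₁, mQ1 W₀ W₁])
  have c01 := card_eq_off_point (U₀ ∩ W₁.image ι) (UQ₀ ∩ WQ₁.image ι) (ι r) (by
      intro x hx
      simp only [Finset.mem_inter]
      have hx' : ι x ≠ r := by intro e; apply hx; rw [← e, hιι x]
      rw [offQ0 U₀ U₁ x hx, mem_image_invol ι hιι, mem_image_invol ι hιι, offQ1 W₀ W₁ (ι x) hx'])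
    (ι r ∈ U₀ ∧ r ∈ W₁) ((ι r ∈ U₀ ∧ ι r ∈ U₁) ∧ (r ∈ W₀ ∨ r ∈ W₁))
    (by rw [Finset.mem_inter, mem_image_invol ι hιι, hιr]) (by rw [Finset.mem_inter, mem_image_invol ι hιι, hιr, mQ0 U₀ U₁, mQ1 W₀ W₁])
  have c10 := card_eq_off_point (U₁ ∩ W₀.image ι) (UQ₁ ∩ WQ₀.image ι) r (by
      intro x hx
      simp only [Finset.mem_inter]
      have hx' : ι x ≠ ι r := by intro e; apply hx; rw [← hιι x, e, hιr]
      rw [offQ1 U₀ U₁ x hx, mem_image_invol ι hιι, mem_image_invol ι hιι, offQ0 W₀ W₁ (ι x) hx'])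
    (r ∈ U₁ ∧ ι r ∈ W₀) ((r ∈ U₀ ∨ r ∈ U₁) ∧ (ι r ∈ W₀ ∧ ι r ∈ W₁))
    (by rw [Finset.mem_inter, mem_image_invol ι hιι]) (by rw [Finset.mem_inter, mem_image_invol ι hιι, mQ1 U₀ U₁, mQ0 W₀ W₁])
  -- constraints on the eight memberships
  have ku1 : r ∈ U₀ → ι r ∈ U₀ := fun h => hU₀ r (ι r) hrr h
  have ku2 : r ∈ U₁ → ι r ∈ U₁ := fun h => hU₁ r (ι r) hrr h
  have ku3 : r ∈ U₀ → r ∉ U₁ → ι r ∈ U₁ := fun h _ => hUb h (ι r) hrr (fun e => hne e.symm)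
  have kw1 : r ∈ W₀ → ι r ∈ W₀ := fun h => hW₀ r (ι r) hrr h
  have kw2 : r ∈ W₁ → ι r ∈ W₁ := fun h => hW₁ r (ι r) hrr h
  have kw3 : r ∈ W₀ → r ∉ W₁ → ι r ∈ W₁ := fun h _ => hWb h (ι r) hrr (fun e => hne e.symm)
  -- the Boolean core
  have core := apex_core (decide (r ∈ U₀)) (decide (r ∈ U₁)) (decide (ι r ∈ U₀)) (decide (ι r ∈ U₁))
    (decide (r ∈ W₀)) (decide (r ∈ W₁)) (decide (ι r ∈ W₀)) (decide (ι r ∈ W₁))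
    (by simpa using ku1) (by simpa using ku2) (by simpa using ku3) (by simpa using hUc)
    (by simpa using kw1) (by simpa using kw2) (by simpa using kw3) (by simpa using hWc)
  simp only [Bool.and_eq_true, Bool.or_eq_true, decide_eq_true_eq] at core
  have hPZ : ((UQ₀ ∩ WQ₁.image ι).card : ℤ) + (UQ₁ ∩ WQ₀.image ι).card ≤ (UQ₀ ∩ WQ₀).card + (UQ₁ ∩ WQ₁).card := by
    exact_mod_cast hP
  have goalZ : ((U₀ ∩ W₁.image ι).card : ℤ) + (U₁ ∩ W₀.image ι).card ≤ (U₀ ∩ W₀).card + (U₁ ∩ W₁).card := by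
    split_ifs at c00 c11 c01 c10 core <;> omega
  exact_mod_cast goalZ

end AntitheticApex

end Summit.CriticalPhenomena.PercolationContinuityZ3.Theorems
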